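import Summits.Ventures.LatticeQCDFlow.Scaling.TaggedPerAttemptCertificateLoneBetween
import Summits.Ventures.LatticeQCDFlow.Scaling.TaggedLoneBetweenBudgetSharp

/-!
HONEST FRAMING: exact (Metropolis-corrected) sampling algorithms for lattice gauge theory; figures
of merit are autocorrelation/cost numbers at stated couplings and volumes; no continuum-physics
claim.

# TaggedPerAttemptCertificateLoneBetweenAll — CONJECTURE W′ FOR THE LONE HUB STRICTLY BETWEEN THE EXTRA PARTICLES AT `K = 2`, HENCE FOR EVERY `K ≥ 2`: THE ONE
# CONFIGURATION LEFT OPEN BY CHAPTER AB IS CLOSED (lean-2 GEN-43, ours)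

Venture-side (OURS).  Cell `lqcd-flow` (pub-lqcd), unit `pub-lqcd-lean-2-g43`, 2026-08-31.  Chapter AC (route (β), the cost side concluded), file 2.  Configuration: `W_b ≤ W_z < W_a`,
`N_C(z) = 1`, every other present content strictly below `W_z` (chapter AB file 13's exclusion; file 16 there did `K ≥ 3`).  The proof is chapter AB file 16's, through the tag position
AT `W_z` (the signed residual `g`-form of AB file 15 for the upper half-move, AB file 9's hub-above bound for the lower half-move), with ONE change: the discounted budget keeps the
powers `α^{n+2}` (file 1 `loneBetween_budget_sharp`: `D_J ≤ (1−σ)(α/(1+α))σc²[1/(1−σ²c²) − α²/(1+σcα)]`), so that the even-attempt part vanishes in the corner `α → 1` where the crude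
form lost `K = 2`; the income is AB file 15b's residual resolvent income unchanged, and the `K = 2` scalar is file 1's `costSide_scalar_loneBetween_two` (margin: ratio ≥ 1.2, toy).
Neither the position of the second particle nor that of `b` enters.

* **`tagged_costSide_loneBetween_two`** (`K = 2`: `L·D_J ≤ 2s1`, `0 ≤ L ≤ 4K+2`), **`tagged_costSide_loneBetween_all`** (every `K ≥ 2`),
  **`tagged_perAttempt_certificate_loneBetween_all`**: `cost(x̃) + cost(ỹ) ≤ L·(x̃(★) + (x̃(a) − ỹ(a)) − D_J)` for every `J`, every `K ≥ 2`.

With chapter AB file 13 this gives Conjecture W′ on EVERY adjacent edge from EVERY ordinary hub for EVERY `K ≥ 2` (file 3 of this chapter).  Literature grade (cell rule): OWN; nothing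
cited; no new bib keys.
-/

open Finset

namespace Summit.Ventures.LatticeQCDFlow.Scaling

section LoneBetweenAll
variable {S : Type*} [Fintype S] [DecidableEq S]
variable {W θ : S → ℝ} {acc : S → S → ℝ} {p : ℝ} {K : ℕ} {NC : S → ℕ} {a b : S} {PX PY : Option S → Option S → ℝ}

/-- **THE COST-SIDE INEQUALITY FOR THE LONE HUB STRICTLY BETWEEN THE EXTRA PARTICLES AT `K = 2`:** `L·D_J ≤ 2s1` for every `0 ≤ L ≤ 4K+2` (sharp budget of file 1, residual income of
chapter AB file 15b, scalar `costSide_scalar_loneBetween_two`). [ours] -/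
theorem tagged_costSide_loneBetween_two (hW : ∀ v, 0 < W v) (hp0 : 0 ≤ p) (hp : ∀ v, p * W v ≤ 1) (hθ : ∀ v, θ v = 1 / (1 + p * W v))
    (hacc : ∀ h v, acc h v = min 1 (W h / W v)) (hK : K = 2) (hNC : ∑ v, NC v = K)
    (hPXoff : ∀ h v, h ≠ v → PX (some h) (some v) = if NC h = 0 then 0 else (NC v : ℝ) / K * acc h v)
    (hPXin : ∀ h, PX (some h) none = if NC h = 0 then 0 else acc h a / K)
    (hPXdiag : ∀ h, PX (some h) (some h) = 1 - (∑ v ∈ univ.erase h, PX (some h) (some v) + PX (some h) none))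
    (hPXout : ∀ v, PX none (some v) = (NC v : ℝ) / K * acc a v) (hPXstay : PX none none = 1 - ∑ v, PX none (some v))
    (hPYoff : ∀ h v, h ≠ v → PY (some h) (some v) = if NC h = 0 then 0 else (NC v : ℝ) / K * acc h v)
    (hPYin : ∀ h, PY (some h) none = if NC h = 0 then 0 else acc h b / K)
    (hPYdiag : ∀ h, PY (some h) (some h) = 1 - (∑ v ∈ univ.erase h, PY (some h) (some v) + PY (some h) none))
    (hPYout : ∀ v, PY none (some v) = (NC v : ℝ) / K * acc b v) (hPYstay : PY none none = 1 - ∑ v, PY none (some v))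
    {z : S} (hz1 : NC z = 1) (hbz : W b ≤ W z) (hza : W z < W a) (hbelow : ∀ w, w ≠ z → NC w ≠ 0 → W w < W z)
    {x y : ℕ → Option S → ℝ}
    (hx0 : ∀ v, x 0 v = if v = some z then 1 else 0) (hxs : ∀ n v, x (n + 1) v = ∑ h, x n h * PX h v)
    (hy0 : ∀ v, y 0 v = if v = some z then 1 else 0) (hys : ∀ n v, y (n + 1) v = ∑ h, y n h * PY h v)
    {M : ℝ} (hM : M = ∑ v, θ v * (NC v : ℝ) + θ a) {L : ℝ} (hL0 : 0 ≤ L) (hL4 : L ≤ 4 * K + 2)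
    {σ : ℝ} (hσ0 : 0 ≤ σ) (hσ1 : σ < 1) {ut : Option S → ℝ} (hut : ∀ t, ut t = (1 - σ) * PX (some z) t + σ * ∑ t', ut t' * PX t' t) (J : ℕ) :
    L * ∑ n ∈ range J, (1 - σ) * σ ^ n * max 0 (y (n + 1) (some z) - x (n + 1) (some z))
      ≤ 2 * ((K + M) * ut none - (∑ v, ut (some v) * (1 - θ v) + ut none * (1 - θ a))) := by
  have hz : NC z ≠ 0 := by rw [hz1]; exact one_ne_zero
  have hK2 : 2 ≤ K := by omega
  have hK1 : 1 ≤ K := by omega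
  have hK0 : (0 : ℝ) < K := by exact_mod_cast (show 0 < K by omega)
  have hKr : (K : ℝ) = 2 := by exact_mod_cast hK
  have hθm := theta_mem hW hp0 hp hθ
  -- the intermediate tagged chain `P_Z` (tag content `z`) and its laws `ζ_n` (verbatim from file 12)
  classical
  obtain ⟨offZ, hoffZ⟩ : ∃ off : S → S → ℝ, ∀ h v, off h v = if NC h = 0 then 0 else (NC v : ℝ) / K * acc h v := ⟨_, fun _ _ => rfl⟩
  obtain ⟨inZ, hinZ⟩ : ∃ f : S → ℝ, ∀ h, f h = if NC h = 0 then 0 else acc h z / K := ⟨_, fun _ => rfl⟩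
  obtain ⟨outZ, houtZ⟩ : ∃ f : S → ℝ, ∀ v, f v = (NC v : ℝ) / K * acc z v := ⟨_, fun _ => rfl⟩
  obtain ⟨PZ, hPZ⟩ : ∃ PZ : Option S → Option S → ℝ, ∀ s t, PZ s t =
      Option.elim s (Option.elim t (1 - ∑ v, outZ v) (fun v => outZ v))
        (fun h => Option.elim t (inZ h) (fun v => if h = v then 1 - (∑ v' ∈ univ.erase h, offZ h v' + inZ h) else offZ h v)) := ⟨_, fun _ _ => rfl⟩
  have hPZoff : ∀ h v, h ≠ v → PZ (some h) (some v) = if NC h = 0 then 0 else (NC v : ℝ) / K * acc h v := fun h v hhv => by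
    rw [hPZ]; simp only [Option.elim]; rw [if_neg hhv, hoffZ]
  have hPZin : ∀ h, PZ (some h) none = if NC h = 0 then 0 else acc h z / K := fun h => by rw [hPZ]; simp only [Option.elim]; rw [hinZ]
  have hPZdiag : ∀ h, PZ (some h) (some h) = 1 - (∑ v ∈ univ.erase h, PZ (some h) (some v) + PZ (some h) none) := fun h => by
    rw [hPZ]; simp only [Option.elim, if_true]; rw [hPZin, hinZ]
    congr 2
    exact sum_congr rfl fun v hv => by rw [hPZoff h v (ne_of_mem_erase hv).symm, hoffZ]
  have hPZout : ∀ v, PZ none (some v) = (NC v : ℝ) / K * acc z v := fun v => by rw [hPZ]; simp only [Option.elim]; rw [houtZ]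
  have hPZstay : PZ none none = 1 - ∑ v, PZ none (some v) := by
    rw [hPZ]; simp only [Option.elim]; congr 1; exact sum_congr rfl fun v _ => by rw [hPZout, houtZ]
  let ζ : ℕ → Option S → ℝ := fun n => Nat.rec (motive := fun _ => Option S → ℝ) (fun v => if v = some z then 1 else 0) (fun _ prev v => ∑ h, prev h * PZ h v) n
  have hζ0 : ∀ v, ζ 0 v = if v = some z then 1 else 0 := fun _ => rfl
  have hζs : ∀ n v, ζ (n + 1) v = ∑ h, ζ n h * PZ h v := fun _ _ => rfl
  -- the upper half-move `(X,Z)`: the residual pair with `b := z`, SIGNED `g`-form (file 15); the lower half-move `(Z,Y)`: the lone hub at the upper tag (file 9 (ii),(iii))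
  have hg := tagged_startClass_residual_g hW hacc hK2 hNC hza.le hPXoff hPXin hPXdiag hPXout hPXstay hPZoff hPZin hPZdiag hPZout hPZstay
    hz1 le_rfl hza hbelow hx0 hxs hζ0 hζs (b := z)
  obtain ⟨-, hBzy, hOzy, -⟩ := tagged_startClass_above_global hW hacc hK2 hNC hbz hPZoff hPZin hPZdiag hPZout hPZstay hPYoff hPYin hPYdiag hPYout hPYstay
    hz le_rfl hζ0 hζs hy0 hys (a := z)
  -- `α = W_z/W_a`, `c = 1/K`
  have hα0 : 0 ≤ W z / W a := div_nonneg (hW z).le (hW a).le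
  have hα1 : W z / W a ≤ 1 := (div_le_one (hW a)).mpr hza.le
  have hc0 : 0 ≤ 1 / (K : ℝ) := by positivity
  have hc2 : 1 / (K : ℝ) = 1 / 2 := by rw [hKr]
  have hσc : σ * (1 / (K : ℝ)) < 1 := by rw [hc2]; nlinarith
  have hzz : W z / W z = 1 := div_self (hW z).ne'
  have hg' : ∀ n, ζ n (some z) - x n (some z)
      ≤ (1 / (K : ℝ)) ^ n * ((-(1:ℝ) - (-(1:ℝ)) ^ (n + 1)) / (1 + 1) - (-(W z / W a) - (-(W z / W a)) ^ (n + 1)) / (1 + W z / W a)) := by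
    intro n; have h := hg n; rwa [hzz] at h
  have hB' : ∀ n, y (n + 1) (some z) - ζ (n + 1) (some z) ≤ if Even n then (1 / (K : ℝ)) ^ (n + 1) / 2 else 0 := hBzy
  -- the SHARP budget (file 1 §1) and the income (chapter AB file 15b §2), both read at `K = 2`
  have hbud := loneBetween_budget_sharp (xz := fun n => x n (some z)) (yz := fun n => y n (some z)) (ζz := fun n => ζ n (some z))
    hα0 hα1 hc0 hσ0 hσ1.le hσc hg' hB' hOzy J
  have hs1 := tagged_residual_income hW hp0 hp hθ hacc hK2 hNC hPXoff hPXin hPXdiag hPXout hPXstay hz1 hza hbelow hM hσ0 hσ1 hut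
  rw [hKr] at hbud hs1 ⊢
  -- the scalar inequality at `K = 2` (file 1 §2) and the chain
  have hL10 : L ≤ 10 := by rw [hKr] at hL4; linarith
  have hscal := costSide_scalar_loneBetween_two hL10 hα0 hα1 (hθm a).1 hσ0 hσ1.le (α := W z / W a) (θa := θ a) (σ := σ)
  calc L * ∑ n ∈ range J, (1 - σ) * σ ^ n * max 0 (y (n + 1) (some z) - x (n + 1) (some z))
      ≤ L * ((1 - σ) * ((W z / W a / (1 + W z / W a)) * (σ * (1 / (2:ℝ)) ^ 2)
          * (1 / (1 - (σ * (1 / (2:ℝ))) ^ 2) - (W z / W a) ^ 2 / (1 + σ * (1 / (2:ℝ)) * (W z / W a))))) :=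
        mul_le_mul_of_nonneg_left hbud hL0
    _ = (1 - σ) * (L * ((W z / W a / (1 + W z / W a)) * (σ * (1 / (2:ℝ)) ^ 2)
          * (1 / (1 - (σ * (1 / (2:ℝ))) ^ 2) - (W z / W a) ^ 2 / (1 + σ * (1 / (2:ℝ)) * (W z / W a))))) := by ring
    _ ≤ (1 - σ) * (2 * ((W z / W a * ((2:ℝ) - 2 + 3 * θ a) / 2 + σ * (W z / W a / 2) * ((1 - W z / W a) * (1 - θ a) / (1 + W z / W a)))
          / ((1 - σ / 2) * (1 + σ * (W z / W a) / 2)))) := mul_le_mul_of_nonneg_left hscal (by linarith only [hσ1])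
    _ = 2 * ((1 - σ) * (W z / W a * ((2:ℝ) - 2 + 3 * θ a) / 2 + σ * (W z / W a / 2) * ((1 - W z / W a) * (1 - θ a) / (1 + W z / W a)))
          / ((1 - σ / 2) * (1 + σ * (W z / W a) / 2))) := by ring
    _ ≤ 2 * ((2 + M) * ut none - (∑ v, ut (some v) * (1 - θ v) + ut none * (1 - θ a))) := mul_le_mul_of_nonneg_left hs1 (by norm_num)

/-- **THE COST-SIDE INEQUALITY FOR THE LONE HUB STRICTLY BETWEEN, EVERY `K ≥ 2`** (`K = 2`: this file; `K ≥ 3`: chapter AB file 16). [ours] -/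
theorem tagged_costSide_loneBetween_all (hW : ∀ v, 0 < W v) (hp0 : 0 ≤ p) (hp : ∀ v, p * W v ≤ 1) (hθ : ∀ v, θ v = 1 / (1 + p * W v))
    (hacc : ∀ h v, acc h v = min 1 (W h / W v)) (hK : 2 ≤ K) (hNC : ∑ v, NC v = K)
    (hPXoff : ∀ h v, h ≠ v → PX (some h) (some v) = if NC h = 0 then 0 else (NC v : ℝ) / K * acc h v)
    (hPXin : ∀ h, PX (some h) none = if NC h = 0 then 0 else acc h a / K)
    (hPXdiag : ∀ h, PX (some h) (some h) = 1 - (∑ v ∈ univ.erase h, PX (some h) (some v) + PX (some h) none))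
    (hPXout : ∀ v, PX none (some v) = (NC v : ℝ) / K * acc a v) (hPXstay : PX none none = 1 - ∑ v, PX none (some v))
    (hPYoff : ∀ h v, h ≠ v → PY (some h) (some v) = if NC h = 0 then 0 else (NC v : ℝ) / K * acc h v)
    (hPYin : ∀ h, PY (some h) none = if NC h = 0 then 0 else acc h b / K)
    (hPYdiag : ∀ h, PY (some h) (some h) = 1 - (∑ v ∈ univ.erase h, PY (some h) (some v) + PY (some h) none))
    (hPYout : ∀ v, PY none (some v) = (NC v : ℝ) / K * acc b v) (hPYstay : PY none none = 1 - ∑ v, PY none (some v))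
    {z : S} (hz1 : NC z = 1) (hbz : W b ≤ W z) (hza : W z < W a) (hbelow : ∀ w, w ≠ z → NC w ≠ 0 → W w < W z)
    {x y : ℕ → Option S → ℝ}
    (hx0 : ∀ v, x 0 v = if v = some z then 1 else 0) (hxs : ∀ n v, x (n + 1) v = ∑ h, x n h * PX h v)
    (hy0 : ∀ v, y 0 v = if v = some z then 1 else 0) (hys : ∀ n v, y (n + 1) v = ∑ h, y n h * PY h v)
    {M : ℝ} (hM : M = ∑ v, θ v * (NC v : ℝ) + θ a) {L : ℝ} (hL0 : 0 ≤ L) (hL4 : L ≤ 4 * K + 2)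
    {σ : ℝ} (hσ0 : 0 ≤ σ) (hσ1 : σ < 1) {ut : Option S → ℝ} (hut : ∀ t, ut t = (1 - σ) * PX (some z) t + σ * ∑ t', ut t' * PX t' t) (J : ℕ) :
    L * ∑ n ∈ range J, (1 - σ) * σ ^ n * max 0 (y (n + 1) (some z) - x (n + 1) (some z))
      ≤ 2 * ((K + M) * ut none - (∑ v, ut (some v) * (1 - θ v) + ut none * (1 - θ a))) := by
  rcases Nat.lt_or_ge 2 K with h3 | h2
  · exact tagged_costSide_loneBetween hW hp0 hp hθ hacc h3 hNC hPXoff hPXin hPXdiag hPXout hPXstay hPYoff hPYin hPYdiag hPYout hPYstay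
      hz1 hbz hza hbelow hx0 hxs hy0 hys hM hL0 hL4 hσ0 hσ1 hut J
  · have hK2 : K = 2 := le_antisymm h2 hK
    exact tagged_costSide_loneBetween_two hW hp0 hp hθ hacc hK2 hNC hPXoff hPXin hPXdiag hPXout hPXstay hPYoff hPYin hPYdiag hPYout hPYstay
      hz1 hbz hza hbelow hx0 hxs hy0 hys hM hL0 hL4 hσ0 hσ1 hut J

/-- **CONJECTURE W′ FOR THE LONE HUB STRICTLY BETWEEN THE EXTRA PARTICLES, EVERY `K ≥ 2`:** `cost(x̃) + cost(ỹ) ≤ L·(x̃(★) + (x̃(a) − ỹ(a)) − D_J)` for every `J` (chapter AB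
file 16's derivation verbatim, with the cost side of this file). [ours] -/
theorem tagged_perAttempt_certificate_loneBetween_all (hW : ∀ v, 0 < W v) (hp0 : 0 ≤ p) (hp : ∀ v, p * W v ≤ 1) (hθ : ∀ v, θ v = 1 / (1 + p * W v))
    (hacc : ∀ h v, acc h v = min 1 (W h / W v)) (hK : 2 ≤ K) (hNC : ∑ v, NC v = K) (hab : W b ≤ W a)
    (hPXoff : ∀ h v, h ≠ v → PX (some h) (some v) = if NC h = 0 then 0 else (NC v : ℝ) / K * acc h v)
    (hPXin : ∀ h, PX (some h) none = if NC h = 0 then 0 else acc h a / K)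
    (hPXdiag : ∀ h, PX (some h) (some h) = 1 - (∑ v ∈ univ.erase h, PX (some h) (some v) + PX (some h) none))
    (hPXout : ∀ v, PX none (some v) = (NC v : ℝ) / K * acc a v) (hPXstay : PX none none = 1 - ∑ v, PX none (some v))
    (hPYoff : ∀ h v, h ≠ v → PY (some h) (some v) = if NC h = 0 then 0 else (NC v : ℝ) / K * acc h v)
    (hPYin : ∀ h, PY (some h) none = if NC h = 0 then 0 else acc h b / K)
    (hPYdiag : ∀ h, PY (some h) (some h) = 1 - (∑ v ∈ univ.erase h, PY (some h) (some v) + PY (some h) none))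
    (hPYout : ∀ v, PY none (some v) = (NC v : ℝ) / K * acc b v) (hPYstay : PY none none = 1 - ∑ v, PY none (some v))
    {z : S} (hz1 : NC z = 1) (hbz : W b ≤ W z) (hza : W z < W a) (hbelow : ∀ w, w ≠ z → NC w ≠ 0 → W w < W z)
    {x y : ℕ → Option S → ℝ}
    (hx0 : ∀ v, x 0 v = if v = some z then 1 else 0) (hxs : ∀ n v, x (n + 1) v = ∑ h, x n h * PX h v)
    (hy0 : ∀ v, y 0 v = if v = some z then 1 else 0) (hys : ∀ n v, y (n + 1) v = ∑ h, y n h * PY h v)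
    {M : ℝ} (hM : M = ∑ v, θ v * (NC v : ℝ) + θ a) {L : ℝ} (hL : L = 2 * K + M + (∑ v, θ v * (NC v : ℝ) + θ b))
    {σ : ℝ} (hσ0 : 0 ≤ σ) (hσ1 : σ < 1) {xt yt xs ys : Option S → ℝ}
    (hxt : ∀ t, xt t = (1 - σ) * PX (some z) t + σ * ∑ t', xt t' * PX t' t) (hyt : ∀ t, yt t = (1 - σ) * PY (some z) t + σ * ∑ t', yt t' * PY t' t)
    (hxsr : ∀ t, xs t = (1 - σ) * PX none t + σ * ∑ t', xs t' * PX t' t) (hysr : ∀ t, ys t = (1 - σ) * PY none t + σ * ∑ t', ys t' * PY t' t) (J : ℕ) :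
    (∑ v, xt (some v) * (1 - θ v) + xt none * (1 - θ a)) + (∑ v, yt (some v) * (1 - θ v) + yt none * (1 - θ b))
      ≤ L * (xt none + (xt (some a) - yt (some a)) - ∑ n ∈ range J, (1 - σ) * σ ^ n * max 0 (y (n + 1) (some z) - x (n + 1) (some z))) := by
  have hz : NC z ≠ 0 := by rw [hz1]; exact one_ne_zero
  have hK1 : 1 ≤ K := by omega
  have hK0r : (0 : ℝ) ≤ K := Nat.cast_nonneg _
  have hθm := theta_mem hW hp0 hp hθ
  have hMY : (∑ v, θ v * (NC v : ℝ) + θ b) = M + (θ b - θ a) := by rw [hM]; ring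
  have hdec := ledger_perStep_eq (θ := θ) (x := xt) (y := yt) (z := z) (a := a)
    (pen := ∑ n ∈ range J, (1 - σ) * σ ^ n * max 0 (y (n + 1) (some z) - x (n + 1) (some z))) hMY hL
  have hDstar := tagged_star_domination hW hacc hK1 hNC hab hPXoff hPXin hPXdiag hPXout hPXstay hPYoff hPYin hPYdiag hPYout hPYstay hσ0 hσ1 hxsr hysr z
  have hs3 := S2_of_star_domination hW hp0 hp hθ hacc hK1 hNC hab hPXoff hPXin hPXdiag hPXout hPXstay hPYoff hPYin hPYout hσ0 hσ1 hz hxt hyt hxsr hysr hDstar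
  have hdom := tagged_hub_domination hW hacc hK1 hNC hab hPXoff hPXin hPXdiag hPXout hPXstay hPYoff hPYin hPYdiag hPYout hPYstay hσ0 hσ1 hz hxt hyt
  have hgap_a : 0 ≤ xt (some a) - yt (some a) := by linarith [hdom a]
  have hgaps : 0 ≤ ∑ v ∈ univ.erase z, (xt (some v) - yt (some v)) * (1 - θ v) :=
    sum_nonneg fun v _ => mul_nonneg (by linarith [hdom v]) (by linarith [(hθm v).2])
  have hez : 0 ≤ -((1 - θ z) * (yt (some z) - xt (some z))) := by
    have h1 : 0 ≤ 1 - θ z := by linarith [(hθm z).2]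
    have h2 : yt (some z) - xt (some z) ≤ 0 := by linarith [hdom z]
    nlinarith [mul_nonneg h1 (neg_nonneg.mpr h2)]
  have hMC : ∑ v, θ v * (NC v : ℝ) ≤ K := by
    calc ∑ v, θ v * (NC v : ℝ) ≤ ∑ v, (NC v : ℝ) := sum_le_sum fun v _ =>
            mul_le_of_le_one_left (Nat.cast_nonneg _) (hθm v).2
      _ = K := by exact_mod_cast hNC
  have hMC0' : 0 ≤ ∑ v, θ v * (NC v : ℝ) := sum_nonneg fun v _ => mul_nonneg (by linarith [(hθm v).1]) (Nat.cast_nonneg _)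
  have hL0' : 0 ≤ L := by rw [hL, hM]; linarith only [hMC0', (hθm a).1, (hθm b).1, hK0r]
  have hL4 : L ≤ 4 * K + 2 := by rw [hL, hM]; linarith only [hMC, (hθm a).2, (hθm b).2]
  have hcost := tagged_costSide_loneBetween_all hW hp0 hp hθ hacc hK hNC hPXoff hPXin hPXdiag hPXout hPXstay hPYoff hPYin hPYdiag hPYout hPYstay
    hz1 hbz hza hbelow hx0 hxs hy0 hys hM hL0' hL4 hσ0 hσ1 hxt J
  have hMC0 : 0 ≤ ∑ v, θ v * (NC v : ℝ) := sum_nonneg fun v _ => mul_nonneg (by linarith [(hθm v).1]) (Nat.cast_nonneg _)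
  have hL0 : 0 ≤ L := by
    have hK0 : (0 : ℝ) ≤ K := Nat.cast_nonneg _
    rw [hL, hM]; nlinarith [(hθm a).1, (hθm b).1]
  have key : 0 ≤ L * (xt none + (xt (some a) - yt (some a)) - ∑ n ∈ range J, (1 - σ) * σ ^ n * max 0 (y (n + 1) (some z) - x (n + 1) (some z)))
      - (∑ v, xt (some v) * (1 - θ v) + xt none * (1 - θ a)) - (∑ v, yt (some v) * (1 - θ v) + yt none * (1 - θ b)) := by
    rw [hdec]
    have hga : 0 ≤ L * (xt (some a) - yt (some a)) := mul_nonneg hL0 hgap_a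
    linarith [hs3, hga, hgaps, hez, hcost]
  linarith

end LoneBetweenAll

end Summit.Ventures.LatticeQCDFlow.Scaling
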